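import Summits.ResolutionOfSingularities.ResolutionOfSingularities.Theorems.PurelyInseparableDim4PhiLineU2Rechoice
import Summits.ResolutionOfSingularities.ResolutionOfSingularities.Theorems.PurelyInseparableDim4PhiLineLinearFrame
import Summits.ResolutionOfSingularities.ResolutionOfSingularities.Theorems.PurelyInseparableDim4ResConeBInfFrames
import HarnessLib
import HarnessLib.Audit.Tags

/-!
# (5,3) B∞ assembly, STUB K part (a): RE-CHOOSING `u₂ := x_m` (the chart letter) IN A CARRIED LINEAR FRAME at a KEEP step —
# the new frame is again invertible, keeps `u₁ = x_h` and the y-rows, kills the step's direction off `u₂`, and has the same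
# polygon data `pts ≠ ∅`, `αs`, `βs`, `δs` (cell `res-dim4-pi`, K2(p) lane, slice C (5,3) TAIL-B)

[OURS · counted 0 · cell `res-dim4-pi` · K2(p) lane (holder res-dim4-p-12 g4, «STUB K `stub_keep` is yours after R2» 2026-08-29
06:02Z; skeleton `BInf-ASSEMBLY-SKELETON.lean` b10e0a76a4b9b1eb) · seat res-dim4-p-7 g4 · over `…PhiLineU2Rechoice` (R2) and
res-dim4-p-11 g4's `…PhiLineLinearFrame` (`X_eq_sum_of_leftInverse`, `span_range_linearFrame_eq_maximalIdeal`) and res-dim4-p-9 g4's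
`…ResConeBInfFrames` (`replaceRow_left_inverse`, `coeff_replaceRow_ne_zero`).]  Nothing here proves
K2(5), the β_h line or resolution of singularities in dimension ≥ 4 / characteristic `p`.  AI kernel work, weaker than expert review.

A carried frame is a matrix `L : Fin (2+2) → Fin 4 → K` of linear forms with left inverse `M`, `u₁`-row `e_h`; its ring frame is
`i ↦ Σ_s L i s · x_s` in `𝒪 = OriginLocalization K 4`.  At a KEEP step with chart letter `m` and direction `dir` (`dir m = 1`,
`dir h = 0`, killed by the y-rows) the KEEP law (p-11's IV `betaS_step_lt_of_keep`) wants `u₂ = x_m`.  **`exists_keep_rechoice`**: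
replacing the `u₂`-row by `e_m` gives a frame `L′` with a left inverse, the same `u₁`- and y-rows, `Σ_t L′ i t · dir t = 0` off `u₂`,
and — since `e_m = a·L_{u₂} + b·L_{u₁} + Σ c_j L_{y_j}` with `a = M m u₂ ≠ 0` (evaluate at `dir`) — the same `pts ≠ ∅`, `αs`, `βs`,
`δs` for any `J ⊆ 𝔪^μ` with `αs > 0` (R2 `u2Rechoice_invariants`).  The linear algebra (`a ≠ 0`, the left inverse of the
row-replaced frame) is res-dim4-p-9 g4's `ResCone.coeff_replaceRow_ne_zero` / `ResCone.replaceRow_left_inverse` (`…ResConeBInfFrames`).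
[cite: CossartJannsenSaito2020, Lemma 13.6] [cite: CossartPiltant2008, proof of Lemma 4.5 (2), pp. 11–12]
bears_on: LADDER-RESOLUTION:D157-DOOR2 (res-dim4-pi · K2(p) · slice C (5,3) TAIL-B · STUB K (a)).  Supports
stmt-ResolutionOfSingularities-16155 (helper).
-/

noncomputable section

open IsLocalRing MvPolynomial
open Literature.AlgebraicGeometry.Resolution (OriginLocalization ringKrullDim_originLocalization)
open Literature.AlgebraicGeometry.Resolution.WeightedOrder

set_option linter.dupNamespace false

namespace Summit.ResolutionOfSingularities.ResolutionOfSingularities.Theorems.PIDim4.PhiLine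

variable {K : Type} [Field K]

/-! ## The re-choice at a KEEP step -/

/-- **STUB K, part (a): re-choosing `u₂ := x_m` in a carried frame.**  See the module docstring.
[cite: CossartJannsenSaito2020, Lemma 13.6] [cite: CossartPiltant2008, proof of Lemma 4.5 (2), pp. 11–12] -/
theorem exists_keep_rechoice (L : Fin (2 + 2) → Fin 4 → K) (M : Fin 4 → Fin (2 + 2) → K)
    (hM : ∀ t s, ∑ i, M t i * L i s = if t = s then 1 else 0) {h m : Fin 4}
    (hLu1 : L (u1 2) = Pi.single h 1) {dir : Fin 4 → K} (hdirm : dir m = 1) (hdirh : dir h = 0)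
    (hrows : ∀ i, i ≠ u1 2 → i ≠ u2 2 → ∑ t, L i t * dir t = 0) {J : Ideal (OriginLocalization K 4)} {μ : ℕ}
    (hJμ : J ≤ maximalIdeal (OriginLocalization K 4) ^ μ)
    (hne : (pts (fun i => algebraMap (MvPolynomial (Fin 4) K) (OriginLocalization K 4) (∑ s, C (L i s) * X s)) J μ).Nonempty)
    (hα : 0 < alphaS (fun i => algebraMap (MvPolynomial (Fin 4) K) (OriginLocalization K 4) (∑ s, C (L i s) * X s)) J μ) :
    ∃ (L' : Fin (2 + 2) → Fin 4 → K) (M' : Fin 4 → Fin (2 + 2) → K),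
      (∀ t s, ∑ i, M' t i * L' i s = if t = s then 1 else 0) ∧ L' (u1 2) = Pi.single h 1 ∧ L' (u2 2) = Pi.single m 1 ∧
      (∀ i, i ≠ u2 2 → L' i = L i) ∧ (∀ i, i ≠ u2 2 → ∑ t, L' i t * dir t = 0) ∧
      (pts (fun i => algebraMap (MvPolynomial (Fin 4) K) (OriginLocalization K 4) (∑ s, C (L' i s) * X s)) J μ).Nonempty ∧
      alphaS (fun i => algebraMap (MvPolynomial (Fin 4) K) (OriginLocalization K 4) (∑ s, C (L' i s) * X s)) J μ =
        alphaS (fun i => algebraMap (MvPolynomial (Fin 4) K) (OriginLocalization K 4) (∑ s, C (L i s) * X s)) J μ ∧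
      betaS (fun i => algebraMap (MvPolynomial (Fin 4) K) (OriginLocalization K 4) (∑ s, C (L' i s) * X s)) J μ =
        betaS (fun i => algebraMap (MvPolynomial (Fin 4) K) (OriginLocalization K 4) (∑ s, C (L i s) * X s)) J μ ∧
      deltaS (fun i => algebraMap (MvPolynomial (Fin 4) K) (OriginLocalization K 4) (∑ s, C (L' i s) * X s)) J μ =
        deltaS (fun i => algebraMap (MvPolynomial (Fin 4) K) (OriginLocalization K 4) (∑ s, C (L i s) * X s)) J μ := by
  classical
  have hu12 : u1 2 ≠ u2 2 := u1_ne_u2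
  -- the rows other than `u₂` kill `dir` (the `u₁`-row is `e_h`, `dir h = 0`)
  have hrows' : ∀ i, i ≠ u2 2 → ∑ t, L i t * dir t = 0 := by
    intro i hi
    by_cases hi1 : i = u1 2
    · subst hi1
      rw [hLu1, Finset.sum_eq_single h (fun t _ ht => by rw [Pi.single_eq_of_ne ht, zero_mul])
        (fun h' => absurd (Finset.mem_univ h) h'), Pi.single_eq_same, one_mul, hdirh]
    · exact hrows i hi1 hi
  -- `a = M m u₂ ≠ 0`: evaluate `e_m = Σ_i M m i · L i` at `dir` (res-dim4-p-9 g4's `coeff_replaceRow_ne_zero`)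
  have hsingle : ∀ (f : Fin 4 → K), ∑ t, (Pi.single m 1 : Fin 4 → K) t * f t = f m := fun f => by
    rw [Finset.sum_eq_single m (fun t _ ht => by rw [Pi.single_eq_of_ne ht, zero_mul])
      (fun h' => absurd (Finset.mem_univ m) h'), Pi.single_eq_same, one_mul]
  have ha' : ∑ t, (Pi.single m 1 : Fin 4 → K) t * M t (u2 2) ≠ 0 :=
    ResCone.coeff_replaceRow_ne_zero hM (piv := u2 2) (v := Pi.single m 1) (w := dir) hrows'
      (by rw [hsingle, hdirm]; exact one_ne_zero)
  have ha : M m (u2 2) ≠ 0 := by rwa [hsingle (fun t => M t (u2 2))] at ha'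
  set L' := Function.update L (u2 2) (Pi.single m 1 : Fin 4 → K) with hL'
  have hL'i : ∀ i, i ≠ u2 2 → L' i = L i := fun i hi => by rw [hL', Function.update_of_ne hi]
  have hL'u2 : L' (u2 2) = Pi.single m 1 := by rw [hL', Function.update_self]
  -- the left inverse of the row-replaced frame (res-dim4-p-9 g4's `replaceRow_left_inverse`)
  obtain ⟨M', hM'⟩ : ∃ M' : Fin 4 → Fin (2 + 2) → K, ∀ t s, ∑ i, M' t i * L' i s = if t = s then 1 else 0 :=
    ⟨_, ResCone.replaceRow_left_inverse hM (u2 2) (Pi.single m 1) ha' hL'u2 hL'i⟩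
  -- the ring frames and the re-choice relation `x_m = a·L_{u₂} + b·L_{u₁} + Σ c_j L_{y_j}`
  set φ : (Fin (2 + 2) → Fin 4 → K) → Fin (2 + 2) → OriginLocalization K 4 :=
    fun N i => algebraMap (MvPolynomial (Fin 4) K) (OriginLocalization K 4) (∑ s, C (N i s) * X s) with hφ
  have hgen := span_range_linearFrame_eq_maximalIdeal L M hM
  have hdim : ringKrullDim (OriginLocalization K 4) = (2 : ℕ) + 2 := by rw [ringKrullDim_originLocalization]; rfl
  have hc' : ∀ i, i ≠ u2 2 → φ L' i = φ L i := fun i hi => by simp only [hφ, hL'i i hi]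
  have hXm : (∑ s, C (L' (u2 2) s) * X s : MvPolynomial (Fin 4) K) = X m := by
    rw [hL'u2, Finset.sum_eq_single m (fun s _ hs => by rw [Pi.single_eq_of_ne hs, C_0, zero_mul])
      (fun h => absurd (Finset.mem_univ m) h), Pi.single_eq_same, C_1, one_mul]
  have hX := X_eq_sum_of_leftInverse L M hM m
  have hu2 : φ L' (u2 2) = algebraMap (MvPolynomial (Fin 4) K) (OriginLocalization K 4) (C (M m (u2 2))) * φ L (u2 2) +
      algebraMap (MvPolynomial (Fin 4) K) (OriginLocalization K 4) (C (M m (u1 2))) * φ L (u1 2) +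
      ∑ j : Fin 2, algebraMap (MvPolynomial (Fin 4) K) (OriginLocalization K 4) (C (M m (Fin.castAdd 2 j))) *
        φ L (Fin.castAdd 2 j) := by
    calc φ L' (u2 2) = algebraMap (MvPolynomial (Fin 4) K) (OriginLocalization K 4) (X m) := by
          simp only [hφ]; rw [hXm]
      _ = ∑ i, algebraMap (MvPolynomial (Fin 4) K) (OriginLocalization K 4) (C (M m i)) * φ L i := by
          rw [hX, map_sum (algebraMap (MvPolynomial (Fin 4) K) (OriginLocalization K 4))]
          simp only [map_mul, hφ]
      _ = (∑ j : Fin 2, algebraMap (MvPolynomial (Fin 4) K) (OriginLocalization K 4) (C (M m (Fin.castAdd 2 j))) *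
              φ L (Fin.castAdd 2 j)) +
            (algebraMap (MvPolynomial (Fin 4) K) (OriginLocalization K 4) (C (M m (u1 2))) * φ L (u1 2) +
              algebraMap (MvPolynomial (Fin 4) K) (OriginLocalization K 4) (C (M m (u2 2))) * φ L (u2 2)) := by
          rw [Fin.sum_univ_add, Fin.sum_univ_two, Fin.sum_univ_two]; rfl
      _ = _ := by ring
  have hunit : IsUnit (algebraMap (MvPolynomial (Fin 4) K) (OriginLocalization K 4) (C (M m (u2 2)))) :=
    isUnit_algebraMap_of_constantCoeff_ne_zero (by rw [constantCoeff_C]; exact ha)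
  obtain ⟨hne', hα', hβ', hδ'⟩ := u2Rechoice_invariants (c := φ L) (c' := φ L') hgen hdim hJμ hne hα hunit hc' hu2
  refine ⟨L', M', hM', by rw [hL'i _ hu12, hLu1], hL'u2, hL'i, fun i hi => by rw [hL'i i hi]; exact hrows' i hi,
    hne', hα', hβ', hδ'⟩

end Summit.ResolutionOfSingularities.ResolutionOfSingularities.Theorems.PIDim4.PhiLine

end
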